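import Literature.AlgebraicGeometry.Resolution.MarkedIdeals
import Literature.AlgebraicGeometry.Resolution.BlowupsProperProofs
import Mathlib.AlgebraicGeometry.Noetherian
import Mathlib.AlgebraicGeometry.Morphisms.Proper
import HarnessLib

/-!
# Multiple blow-ups of marked ideals: composition, properness, a first resolution

Topic: `Literature/AlgebraicGeometry/Resolution`. First properties of the multiple blow-ups and
resolutions of marked ideals of `MarkedIdeals.lean` (Bierstone–Grigoriev–Milman–Włodarczyk,
arXiv:1206.3090, Defs. 3.1.3–3.1.4), all PROVED:

* `IsMultipleBlowup.trans`, `IsMarkedResolution.of_trans` — multiple blow-ups compose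
  (BGMW §3.2: transforms along multiple blow-ups);
* `IsMultipleBlowup.length_boundary_le` — the boundary grows;
* `IsMultipleBlowup.isProper_and_isLocallyNoetherian`, `.isProper`, `.isLocallyNoetherian`,
  `IsMarkedResolution.isProper` — over a locally Noetherian scheme a multiple blow-up is a
  proper morphism from a locally Noetherian scheme (blow-ups are proper, `IsBlowup.isProper` =
  Stacks 02NS / Görtz–Wedhorn Prop. 13.96 (1), now unconditional; proper ⇒ locally of finite
  type ⇒ locally Noetherian source);
* `controlledTransform_self_one`, `isMarkedResolution_blowup_centre` — **blowing up a regular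
  centre `C` having simple normal crossings with `E` resolves `(X, 𝓘_C, E, 1)` in one step**
  (non-vacuity of `IsMarkedResolution`; the mechanism of BGMW §3.3 (2) ⇒ (3)); if `C` is a
  divisor the blow-up is an isomorphism (`IsBlowup.isIso`, BGMW §2, Remarks (1)).

## Sources

* [BGMW 2011] Defs. 3.1.3–3.1.4, §3.2, §3.3, §2 Remarks (1) (arXiv numbering).
  [BierstoneGrigorievMilmanWlodarczyk2011]
* U. Görtz, T. Wedhorn, *Algebraic Geometry I*, 2nd ed. (2020), Prop. 13.96 (1). [GortzWedhorn2020]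
-/

noncomputable section

open CategoryTheory CategoryTheory.Limits AlgebraicGeometry TopologicalSpace IsLocalRing

namespace Literature.AlgebraicGeometry.Resolution

universe u

/-! ## Composition of multiple blow-ups -/

section Basic

variable {X : Scheme.{u}}

/-- Multiple blow-ups compose: a multiple blow-up of a transform `M'` of `M`, performed after
the multiple blow-up producing `M'`, is a multiple blow-up of `M` (BGMW §3.2: the controlled
transform "makes sense … for a multiple blow-up"; `(𝓘, μ)_i = σ^{i c}(𝓘, μ)`).
[cite: BierstoneGrigorievMilmanWlodarczyk2011, §3.2] -/
theorem IsMultipleBlowup.trans {M : MarkedIdeal X} {X' : Scheme.{u}} {σ : X' ⟶ X}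
    {M' : MarkedIdeal X'} (h : IsMultipleBlowup M σ M') {X'' : Scheme.{u}} {τ : X'' ⟶ X'}
    {M'' : MarkedIdeal X''} (h' : IsMultipleBlowup M' τ M'') : IsMultipleBlowup M (τ ≫ σ) M'' := by
  induction h' with
  | refl => simpa using h
  | blowup _ C ρ hρ hC hsupp hsnc ih =>
    simpa only [Category.assoc] using IsMultipleBlowup.blowup ih C ρ hρ hC hsupp hsnc

/-- A resolution of a transform, appended to the multiple blow-up producing it, is a resolution.
[cite: BierstoneGrigorievMilmanWlodarczyk2011, Def. 3.1.3] -/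
theorem IsMarkedResolution.of_trans {M : MarkedIdeal X} {X' : Scheme.{u}} {σ : X' ⟶ X}
    {M' : MarkedIdeal X'} (h : IsMultipleBlowup M σ M') {X'' : Scheme.{u}} {τ : X'' ⟶ X'}
    {M'' : MarkedIdeal X''} (h' : IsMarkedResolution M' τ M'') : IsMarkedResolution M (τ ≫ σ) M'' :=
  ⟨h.trans h'.1, h'.2⟩

/-- The boundary only grows along a multiple blow-up: its length is the initial length plus the
number of blow-ups, in particular at least the initial length. [folklore] -/
theorem IsMultipleBlowup.length_boundary_le {M : MarkedIdeal X} {X' : Scheme.{u}} {σ : X' ⟶ X}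
    {M' : MarkedIdeal X'} (h : IsMultipleBlowup M σ M') :
    M.boundary.length ≤ M'.boundary.length := by
  induction h with
  | refl => exact le_rfl
  | blowup _ C τ _ _ _ _ ih =>
    refine ih.trans ?_
    simp [MarkedIdeal.transform_boundary]

end Basic

/-! ## Multiple blow-ups are proper and preserve local Noetherianity -/

section Proper

variable {X : Scheme.{u}}

/-- **A multiple blow-up of a locally Noetherian scheme is proper, and its source is again
locally Noetherian** (each blow-up is proper — `IsBlowup.isProper`, Stacks 02NS / GW 13.96 (1) —
hence locally of finite type, and locally of finite type over locally Noetherian is locally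
Noetherian). [cite: GortzWedhorn2020, Prop. 13.96 (1)] -/
theorem IsMultipleBlowup.isProper_and_isLocallyNoetherian [IsLocallyNoetherian X]
    {M : MarkedIdeal X} {X' : Scheme.{u}} {σ : X' ⟶ X} {M' : MarkedIdeal X'}
    (h : IsMultipleBlowup M σ M') : IsProper σ ∧ IsLocallyNoetherian X' := by
  induction h with
  | refl => exact ⟨inferInstance, inferInstance⟩
  | blowup _ C τ hτ _ _ _ ih =>
    obtain ⟨hσ, hX'⟩ := ih
    haveI := hX'
    haveI := hσ
    haveI : IsProper τ := hτ.isProper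
    exact ⟨inferInstance, LocallyOfFiniteType.isLocallyNoetherian τ⟩

/-- A multiple blow-up of a locally Noetherian scheme is proper. [cite: GortzWedhorn2020, Prop. 13.96 (1)] -/
theorem IsMultipleBlowup.isProper [IsLocallyNoetherian X] {M : MarkedIdeal X} {X' : Scheme.{u}}
    {σ : X' ⟶ X} {M' : MarkedIdeal X'} (h : IsMultipleBlowup M σ M') : IsProper σ :=
  h.isProper_and_isLocallyNoetherian.1

/-- The source of a multiple blow-up of a locally Noetherian scheme is locally Noetherian.
[folklore] -/
theorem IsMultipleBlowup.isLocallyNoetherian [IsLocallyNoetherian X] {M : MarkedIdeal X}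
    {X' : Scheme.{u}} {σ : X' ⟶ X} {M' : MarkedIdeal X'} (h : IsMultipleBlowup M σ M') :
    IsLocallyNoetherian X' :=
  h.isProper_and_isLocallyNoetherian.2

/-- A resolution of a marked ideal on a locally Noetherian scheme is a proper morphism.
[cite: GortzWedhorn2020, Prop. 13.96 (1)] -/
theorem IsMarkedResolution.isProper [IsLocallyNoetherian X] {M : MarkedIdeal X} {X' : Scheme.{u}}
    {σ : X' ⟶ X} {M' : MarkedIdeal X'} (h : IsMarkedResolution M σ M') : IsProper σ :=
  h.1.isProper

end Proper

/-! ## The blow-up of the centre itself resolves `(X, 𝓘_C, E, 1)` -/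

section Self

variable {X X' : Scheme.{u}}

/-- The controlled transform of the centre itself with multiplicity one is the unit ideal:
`𝓘(D)^{-1} σ^*(𝓘_C) = 𝓘(D)^{-1} 𝓘(D) = 𝒪_{X'}`. [folklore] -/
theorem controlledTransform_self_one (σ : X' ⟶ X) (C : X.IdealSheafData) :
    controlledTransform σ C C 1 = ⊤ := by
  refine top_le_iff.mp (le_colon_iff.mpr ?_)
  rw [pow_one, Scheme.IdealSheafData.mul_top]

/-- **Blowing up a regular centre `C` (with simple normal crossings with `E`) resolves the marked
ideal `(X, 𝓘_C, E, 1)` in one step** — the transform is `(X', 𝒪_{X'}, σᶜ(E) ∪ {D}, 1)`, of empty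
support. Non-vacuity of `IsMarkedResolution`; cf. BGMW §3.3 (2) ⇒ (3), where the strict
transform of `Y` eventually "is the center of a blow-up".
[cite: BierstoneGrigorievMilmanWlodarczyk2011, Def. 3.1.3] -/
theorem isMarkedResolution_blowup_centre {C : X.IdealSheafData} {E : List X.IdealSheafData}
    (σ : X' ⟶ X) (hσ : IsBlowup σ C) (hC : Scheme.IsRegular C.subscheme) (hsnc : HasSNCWith E C) :
    IsMarkedResolution (⟨C, E, 1⟩ : MarkedIdeal X) σ ((⟨C, E, 1⟩ : MarkedIdeal X).transform σ C) := by
  refine ⟨IsMultipleBlowup.single _ C σ hσ hC ?_ hsnc, ?_⟩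
  · rw [MarkedIdeal.support_of_mult_eq_one _ rfl]
  · rw [MarkedIdeal.support_of_mult_eq_one _ rfl, MarkedIdeal.transform_ideal]
    change ((controlledTransform σ C C 1).support : Set X') = ∅
    rw [controlledTransform_self_one, Scheme.IdealSheafData.support_top]
    rfl

end Self

end Literature.AlgebraicGeometry.Resolution

end
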